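import Mathlib
import Literature.Computability.AlgebraicComplexity.StandardFamiliesProofs
import Summits.ValiantsHypothesis.ValiantsHypothesis.Theorems.ChowBorderDepth3ChowBorderBoundGoodPerm
import Summits.ValiantsHypothesis.ValiantsHypothesis.Theorems.ChowBorderDepth3ChowBorderBoundCoeffGraphSubst
import Summits.ValiantsHypothesis.ValiantsHypothesis.Theorems.ChowBorderDepth3ChowBorderBoundFanInBelowN
import Summits.ValiantsHypothesis.ValiantsHypothesis.Theorems.ChowBorderDepth3ChowBorderBoundBorderFanInOne

/-!
# `ChowBorderDepth3.ChowBorderBound` along the top-fan-in axis: the first rungs, assembled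

Sub-goals of crux `stmt-ValiantsHypothesis-5936`
(`Summit.ValiantsHypothesis.ValiantsHypothesis.Theses.ChowBorderDepth3.ChowBorderBound`: for
`r, D ≤ (n+2)^(c⌊√n⌋+c)` there are no affine forms `ℓ_ij` over `ℂ[ε]` with
`Σ_{i<r} Π_{j<D} ℓ_ij = ε^q per_n + ε^(q+1) G`), line `registered`, lead c2.  This file assembles
the four landed stubs of wave 1 into the rungs they were cut from:

* `permNonvanishing` — replacing FEWER THAN `n` entries of the generic `n × n` matrix by arbitrary
  polynomials never makes the permanent a constant (stubs `GoodPerm.stub_goodPerm` +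
  `CoeffGraphSubst.stub_coeffGraphSubst`: a pivot-avoiding permutation monomial keeps coefficient
  `1`).  Equivalently: `per_n` vanishes on no linear subspace of `ℂ^(n×n)` cut out by `< n` linear
  forms and is constant on no affine subspace of codimension `< n`.
* `perPoly_ne_sps_of_lt` — hence `per_n` has NO exact ΣΠΣ expression over `ℂ` with top fan-in
  `r < n`, for any number `D` of affine factors (stub `FanInBelowN.stub_fanInBelowN`): the crux's
  classical (`q = 0`) slice below fan-in `n`, with no bound on `D` at all.
* `chowBorderBound_fanInLeOne` — the crux VERBATIM at top fan-in `r ≤ 1`, for every `n ≥ 2`,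
  every `D` and every `q` (stub `BorderFanInOne.stub_borderFanInOne`): a border product of affine
  forms over `ℂ[ε]` degenerates to a product of affine forms over `ℂ`, and `per_n` is irreducible
  of degree `n ≥ 2`.

These are the base cases of the exact divide–derive calculus over `ℂ(x)((ε))` by which the lead
attacks the crux at bounded top fan-in (`r = 2`: `D ≥ 2^{Ω(n)}`, in progress); every such rung
ends in a classical case that `perPoly_ne_sps_of_lt` discharges.
-/

set_option linter.dupNamespace false

namespace Summit.ValiantsHypothesis.ValiantsHypothesis.Theorems.ChowBorderBound.FanInRungs

open MvPolynomial
open Literature.Computability.AlgebraicComplexity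
open scoped BigOperators Polynomial

/-- **PermNonvanishing.**  Let `P` be a set of fewer than `n` cells of the `n × n` grid and replace
the generic entries `X_p`, `p ∈ P`, by arbitrary polynomials `g p`.  The resulting permanent is not
a constant: by `stub_goodPerm` there is a permutation `σ` avoiding `P` with a compatible column
ranking, and by `stub_coeffGraphSubst` its monomial `Π_i X_{(σ i, i)}` has coefficient `1`, whereas
every non-trivial monomial of `C c` has coefficient `0`. -/
theorem permNonvanishing :
    ∀ (n : ℕ) (P : Finset (Fin n × Fin n))
      (g : Fin n × Fin n → MvPolynomial (Fin n × Fin n) ℂ) (c : ℂ), P.card < n →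
      MvPolynomial.aeval
          (fun v : Fin n × Fin n =>
            if v ∈ P then g v else (MvPolynomial.X v : MvPolynomial (Fin n × Fin n) ℂ))
          (Literature.Computability.AlgebraicComplexity.perPoly (Fin n) ℂ) ≠
        MvPolynomial.C c := by
  intro n P g c hcard heq
  obtain ⟨σ, rk, hrk, hσ, hlt⟩ := GoodPerm.stub_goodPerm n P hcard
  have h1 := CoeffGraphSubst.stub_coeffGraphSubst n P g σ rk hrk hσ hlt
  rw [heq, MvPolynomial.coeff_C] at h1
  have hn : 0 < n := lt_of_le_of_lt (Nat.zero_le _) hcard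
  have hm : (0 : Fin n × Fin n →₀ ℕ) ≠ ∑ i : Fin n, Finsupp.single (σ i, i) (1 : ℕ) := by
    intro h0
    have h2 := congrArg (fun f : Fin n × Fin n →₀ ℕ => f (σ ⟨0, hn⟩, ⟨0, hn⟩)) h0
    simp only [Finsupp.coe_zero, Pi.zero_apply, Finsupp.coe_finsetSum, Finset.sum_apply] at h2
    have h3 : (1 : ℕ) ≤ ∑ i : Fin n, (Finsupp.single (σ i, i) (1 : ℕ)) (σ ⟨0, hn⟩, ⟨0, hn⟩) :=
      le_trans (by simp) (Finset.single_le_sum (f := fun i : Fin n =>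
        (Finsupp.single (σ i, i) (1 : ℕ)) (σ ⟨0, hn⟩, ⟨0, hn⟩)) (fun _ _ => Nat.zero_le _)
        (Finset.mem_univ (⟨0, hn⟩ : Fin n)))
    omega
  rw [if_neg hm] at h1
  exact zero_ne_one h1

/-- **Rung (exact, top fan-in `r < n`).**  The permanent `per_n` has no exact ΣΠΣ expression
`Σ_{i<r} Π_{j<D} ℓ_ij` over `ℂ` with affine `ℓ_ij` and top fan-in `r < n`, whatever `D` is — the
crux's `q = 0` slice below fan-in `n` (`stub_fanInBelowN` applied to `permNonvanishing`). -/
theorem perPoly_ne_sps_of_lt :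
    ∀ (n r D : ℕ), r < n → ∀ (ℓ : Fin r → Fin D → MvPolynomial (Fin n × Fin n) ℂ),
      (∀ i j, (ℓ i j).totalDegree ≤ 1) →
      (∑ i, ∏ j, ℓ i j) ≠ Literature.Computability.AlgebraicComplexity.perPoly (Fin n) ℂ :=
  FanInBelowN.stub_fanInBelowN permNonvanishing

/-- The border target `ε^q per_n + ε^(q+1) G` is never `0`: cancel `ε^q` (the coefficient ring
`ℂ[ε]` makes `MvPolynomial` a domain) and reduce `per_n + ε G` modulo `ε`. -/
theorem borderTarget_ne_zero (n q : ℕ) (G : MvPolynomial (Fin n × Fin n) ℂ[X]) :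
    C (Polynomial.X ^ q) * MvPolynomial.map Polynomial.C (perPoly (Fin n) ℂ) +
        C (Polynomial.X ^ (q + 1)) * G ≠ 0 := by
  intro h
  have hX : (C (Polynomial.X ^ q) : MvPolynomial (Fin n × Fin n) ℂ[X]) ≠ 0 :=
    (C_ne_zero).2 (pow_ne_zero _ Polynomial.X_ne_zero)
  have h1 : C (Polynomial.X ^ q) *
      (MvPolynomial.map Polynomial.C (perPoly (Fin n) ℂ) + C Polynomial.X * G) = 0 := by
    rw [← h, pow_succ, map_mul]; ring
  have h2 := (mul_eq_zero.1 h1).resolve_left hX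
  have h3 := congrArg (MvPolynomial.map (Polynomial.evalRingHom (0 : ℂ))) h2
  rw [map_add, map_mul, map_C, map_map, map_zero] at h3
  have hid : (Polynomial.evalRingHom (0 : ℂ)).comp Polynomial.C = RingHom.id ℂ := by
    ext x; simp
  rw [hid, map_id] at h3
  simp only [Polynomial.coe_evalRingHom, Polynomial.eval_X, map_zero, zero_mul, add_zero] at h3
  exact perPoly_ne_zero (Fin n) ℂ h3

/-- **Rung (border, top fan-in `r ≤ 1`).**  The crux `ChowBorderDepth3.ChowBorderBound` VERBATIM
at top fan-in `r ≤ 1`: for every `n ≥ 2`, every `D` and every `q` there are no affine forms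
`ℓ_0j` over `ℂ[ε]` and no `G` with `Π_{j<D} ℓ_0j = ε^q per_n + ε^(q+1) G` (and for `r = 0` the
empty sum is not the border target).  No size bound on `D` or `q` is needed at this fan-in. -/
theorem chowBorderBound_fanInLeOne :
    ∀ n : ℕ, 2 ≤ n → ∀ r D : ℕ, r ≤ 1 →
    ¬ ∃ (q : ℕ) (ℓ : Fin r → Fin D → MvPolynomial (Fin n × Fin n) (Polynomial ℂ))
        (G : MvPolynomial (Fin n × Fin n) (Polynomial ℂ)),
        (∀ i j, (ℓ i j).totalDegree ≤ 1) ∧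
        (∑ i, ∏ j, ℓ i j) = MvPolynomial.C (Polynomial.X ^ q) *
            MvPolynomial.map Polynomial.C
              (Literature.Computability.AlgebraicComplexity.perPoly (Fin n) ℂ) +
          MvPolynomial.C (Polynomial.X ^ (q + 1)) * G := by
  intro n hn r D hr ⟨q, ℓ, G, hdeg, hsum⟩
  rcases Nat.lt_or_ge r 1 with hr0 | hr1
  · obtain rfl : r = 0 := by omega
    simp only [Finset.univ_eq_empty, Finset.sum_empty] at hsum
    exact borderTarget_ne_zero n q G hsum.symm
  · obtain rfl : r = 1 := le_antisymm hr hr1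
    rw [Fin.sum_univ_one] at hsum
    exact BorderFanInOne.stub_borderFanInOne n hn D q (ℓ 0) G (fun j => hdeg 0 j) hsum

end Summit.ValiantsHypothesis.ValiantsHypothesis.Theorems.ChowBorderBound.FanInRungs
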